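import Mathlib

/-!
# Hodge-locus census — THEOREM J2∞ bookkeeping: the triangular witness families of the jump locus, the `d = 4` pencil, and the arithmetic of the piece flag

certified instances and evidence bearing on the general Hodge conjecture; no claim.

pub-hlocus ENGINE B (seat ivhs-2), gen 33, record `pub-hlocus-ivhs-2/ENGINEB-g33.md` §4d (def-free, notation-free helper of
`stmt-HodgeConjecture-16267`; companion of `HodgeLocusCensusJumpStratum.lean` (J1) and `HodgeLocusCensusJumpFlag.lean` (J2)).

Setting (record §4b/§4d).  In the c′ = 1 cell `(2k′, d, k′-1)`, `d ≥ 4`, a member restricts to `(h_0,…,h_{k′-1}; g)`, `h` a complete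
intersection of forms of degree `d-1` in `x_0,…,x_{k′-1}`, `g` of degree `d-2`; the census jump is `b = dim{q ∈ S_2 : g q ∈ (h)_d}` and a
kernel vector is `(q; ℓ)` with `g q = Σ ℓ_j h_j`.  THEOREM J2∞ of the record needs, on every one of the `2k′` pieces of `{b ≥ 1}`, ONE point
with `(h)` c.i. and `b = 1`; §4d supplies them for all `k′ ≥ 3`, `d ≥ 4` by three TRIANGULAR families (`h_j = x_j^{d-1} +` terms divisible by a
later variable ⇒ c.i. by back-substitution, and a Gröbner basis, so `b` is a normal-form computation done once for all `d` in the record).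

KERNEL-CHECKED HERE (polynomial identities in an arbitrary commutative ring, exponent `d = n + 4` symbolic; integer identities of
binomials for all `m`, `d`; one finite table):
* `family_r_identity` (all `r = s + 2 ≥ 2`, all `d`), `family_two_identity`, `family_three_identity` : the kernel identity
  `g·q = Σ ℓ_j h_j` of the family `F_r` (serving `Q_r`, `G_r` and, for `r = k′`, `Σ°`): telescoping;
* `family_Pprime_identity`, `family_Qtwo_identity` : the same for `F_P′` (piece `P′ = G_1`) and `F_Q2` (piece `Q_2`);
* `pencil_syzygy`, `pencil_kernel`, `pencil_plane` : the `d = 4` PENCIL LEMMA of the record's SUPPLEMENT G₂(4) — on `T_{G_2}` at `d = 4`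
  (`h_1 = g_1 q - u x_2`, `h_2 = g_2 q + u x_1`, `g = x_1 g_1 + x_2 g_2`, `u` a quadric) every `(q - t u; x_1 + t g_2, x_2 - t g_1)` is a kernel
  vector and `g ∈ (x_1 + t g_2, x_2 - t g_1)`, whence `β ≥ 2` there; `lemmaO_restriction` : the explicit non-vanishing used in LEMMA O;
* `baseQ_step`, `baseG_step`, `baseQ_pred_sub_baseG` : the three binomial identities of the ARITHMETIC LEMMA
  (`BASE_Q(m) = m² + C(m+1,2) - C(m+d-1,d)`, `BASE_G(m) = m² + C(m+d-3,d-2) - C(m+d-1,d)`), all `m`, all `d = e + 4`;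
* `baseQ_step_neg`, `baseG_step_neg` : both steps are negative for `m ≥ 3` (so `BASE` decreases from `m = 3` on), all `d ≥ 4`;
* `orderings_box` : for `4 ≤ k′ ≤ 8`, `4 ≤ d ≤ 10` the ORDERINGS used by the maximality argument of §4d, by `decide` on the explicit lists.
NOT kernel-checked: the normal-form computations of `β`, LEMMA T (triangular ⇒ c.i.), LEMMA O's openness, (J2-i)/(J2-ii), the exclusions.
-/

namespace Summit.HodgeConjecture.HodgeConjecture.HodgeLocus.Census.JumpFamilies

section Families

variable {R : Type*} [CommRing R]

/-- Family `F_r`, `r = s + 2 ≥ 2`, degree `d = n + 4`: with `h_j = x_j^{d-1} - x_{j+1}^{d-2} x_{j+2}` (`j ≤ r-3`),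
`h_{r-2} = x_{r-2}^{d-1} - x_0 x_{r-1}^{d-2}`, `h_{r-1} = x_{r-1}^{d-1}` and `ℓ = (x_1, …, x_{r-1}, x_0)`, the sum `Σ ℓ_j h_j`
telescopes to `x_0^{d-1} x_1 = g·q` with `g = x_0^{d-3} x_1`, `q = x_0²`. -/
theorem family_r_identity (x : ℕ → R) (s n : ℕ) :
    (∑ j ∈ Finset.range s, x (j + 1) * (x j ^ (n + 3) - x (j + 1) ^ (n + 2) * x (j + 2)))
      + x (s + 1) * (x s ^ (n + 3) - x 0 * x (s + 1) ^ (n + 2)) + x 0 * x (s + 1) ^ (n + 3)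
      = (x 0 ^ (n + 1) * x 1) * x 0 ^ 2 := by
  have key : ∀ s : ℕ, (∑ j ∈ Finset.range s, x (j + 1) * (x j ^ (n + 3) - x (j + 1) ^ (n + 2) * x (j + 2)))
      = x 1 * x 0 ^ (n + 3) - x (s + 1) * x s ^ (n + 3) := by
    intro s
    induction s with
    | zero => simp
    | succ s ih => rw [Finset.sum_range_succ, ih]; ring
  rw [key]; ring

/-- `F_2` written out (`d = n + 4`): `x_1·(x_0^{d-1} - x_0 x_1^{d-2}) + x_0·x_1^{d-1} = (x_0^{d-3} x_1)·x_0²`. -/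
theorem family_two_identity (x0 x1 : R) (n : ℕ) :
    x1 * (x0 ^ (n + 3) - x0 * x1 ^ (n + 2)) + x0 * x1 ^ (n + 3) = (x0 ^ (n + 1) * x1) * x0 ^ 2 := by
  ring

/-- `F_3` written out (`d = n + 4`): `x_1 h_0 + x_2 h_1 + x_0 h_2 = (x_0^{d-3} x_1)·x_0²`. -/
theorem family_three_identity (x0 x1 x2 : R) (n : ℕ) :
    x1 * (x0 ^ (n + 3) - x1 ^ (n + 2) * x2) + x2 * (x1 ^ (n + 3) - x0 * x2 ^ (n + 2)) + x0 * x2 ^ (n + 3)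
      = (x0 ^ (n + 1) * x1) * x0 ^ 2 := by
  ring

/-- Family `F_P′` (`d = n + 4`): `h_0 = x_0^{d-1} + x_0^{d-3} x_1²`, `g = x_0^{d-2}`, `q = x_0² + x_1²`, `ℓ = (x_0, 0, …)`:
`x_0·h_0 = g·q`. -/
theorem family_Pprime_identity (x0 x1 : R) (n : ℕ) :
    x0 * (x0 ^ (n + 3) + x0 ^ (n + 1) * x1 ^ 2) = x0 ^ (n + 2) * (x0 ^ 2 + x1 ^ 2) := by
  ring

/-- Family `F_Q2` (`d = n + 4`): `h_0 = x_0^{d-1}`, `h_1 = x_1^{d-1} + x_1 x_2^{d-2}`, `g = x_0^{d-2} + x_1^{d-2} + x_2^{d-2}`, `q = x_0 x_1`,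
`ℓ = (x_1, x_0, 0, …)`: `x_1 h_0 + x_0 h_1 = g·q`. -/
theorem family_Qtwo_identity (x0 x1 x2 : R) (n : ℕ) :
    x1 * x0 ^ (n + 3) + x0 * (x1 ^ (n + 3) + x1 * x2 ^ (n + 2))
      = (x0 ^ (n + 2) + x1 ^ (n + 2) + x2 ^ (n + 2)) * (x0 * x1) := by
  ring

end Families

section Pencil

variable {R : Type*} [CommRing R]

/-- PENCIL LEMMA, syzygy form (`d = 4`, piece `G_2`): `g_2 h_1 - g_1 h_2 = -u·g`. -/
theorem pencil_syzygy (g1 g2 q u x1 x2 : R) :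
    g2 * (g1 * q - u * x2) - g1 * (g2 * q + u * x1) = -(u * (x1 * g1 + x2 * g2)) := by
  ring

/-- PENCIL LEMMA, kernel form: for every `t`, `g·(q - t u) = (x_1 + t g_2)·h_1 + (x_2 - t g_1)·h_2`, i.e.
`(q - t u; x_1 + t g_2, x_2 - t g_1, 0, …)` is a kernel vector at every point of `T_{G_2}` (`d = 4`). -/
theorem pencil_kernel (g1 g2 q u x1 x2 t : R) :
    (x1 * g1 + x2 * g2) * (q - t * u) = (x1 + t * g2) * (g1 * q - u * x2) + (x2 - t * g1) * (g2 * q + u * x1) := by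
  ring

/-- PENCIL LEMMA, branch form: `g = (x_1 + t g_2) g_1 + (x_2 - t g_1) g_2` lies in the ideal of the moving plane `W_t`, so every
pencil member is of type `G_2`. -/
theorem pencil_plane (g1 g2 x1 x2 t : R) :
    (x1 + t * g2) * g1 + (x2 - t * g1) * g2 = x1 * g1 + x2 * g2 := by
  ring

/-- LEMMA O, the explicit point `g_1 = x_3`, `g_2 = x_4`, `q = x_3² + x_4²`, `u = x_1 x_2`: on `V(W_t) = {x_1 = -t x_4, x_2 = t x_3}` the
pencil quadric `q - t u` restricts to `x_3² + x_4² + t³ x_3 x_4` (never the zero form). -/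
theorem lemmaO_restriction (x3 x4 t : R) :
    (x3 ^ 2 + x4 ^ 2) - t * ((-(t * x4)) * (t * x3)) = x3 ^ 2 + x4 ^ 2 + t ^ 3 * x3 * x4 := by
  ring

end Pencil

section Arithmetic

/-- `BASE_Q(m+1) - BASE_Q(m) = 3m + 2 - C(m+d-1, d-1)` (`d = e + 4`; `BASE_Q(m) = m² + C(m+1,2) - C(m+d-1,d)`). -/
theorem baseQ_step (m e : ℕ) :
    (((m + 1) ^ 2 : ℕ) : ℤ) + ((Nat.choose (m + 2) 2 : ℕ) : ℤ) - ((Nat.choose (m + e + 4) (e + 4) : ℕ) : ℤ)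
      - (((m ^ 2 : ℕ) : ℤ) + ((Nat.choose (m + 1) 2 : ℕ) : ℤ) - ((Nat.choose (m + e + 3) (e + 4) : ℕ) : ℤ))
      = 3 * (m : ℤ) + 2 - ((Nat.choose (m + e + 3) (e + 3) : ℕ) : ℤ) := by
  have h1 : Nat.choose (m + 2) 2 = (m + 1) + Nat.choose (m + 1) 2 := by
    rw [show m + 2 = (m + 1) + 1 by ring, Nat.choose_succ_succ, Nat.choose_one_right]
  have h2 : Nat.choose (m + e + 4) (e + 4) = Nat.choose (m + e + 3) (e + 3) + Nat.choose (m + e + 3) (e + 4) := by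
    rw [show m + e + 4 = (m + e + 3) + 1 by ring, show e + 4 = (e + 3) + 1 by ring, Nat.choose_succ_succ]
  rw [h1, h2]; push_cast; ring

/-- `BASE_G(m+1) - BASE_G(m) = 2m + 1 + C(m+d-3, d-3) - C(m+d-1, d-1)` (`d = e + 4`; `BASE_G(m) = m² + C(m+d-3,d-2) - C(m+d-1,d)`). -/
theorem baseG_step (m e : ℕ) :
    (((m + 1) ^ 2 : ℕ) : ℤ) + ((Nat.choose (m + e + 2) (e + 2) : ℕ) : ℤ) - ((Nat.choose (m + e + 4) (e + 4) : ℕ) : ℤ)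
      - (((m ^ 2 : ℕ) : ℤ) + ((Nat.choose (m + e + 1) (e + 2) : ℕ) : ℤ) - ((Nat.choose (m + e + 3) (e + 4) : ℕ) : ℤ))
      = 2 * (m : ℤ) + 1 + ((Nat.choose (m + e + 1) (e + 1) : ℕ) : ℤ) - ((Nat.choose (m + e + 3) (e + 3) : ℕ) : ℤ) := by
  have h1 : Nat.choose (m + e + 2) (e + 2) = Nat.choose (m + e + 1) (e + 1) + Nat.choose (m + e + 1) (e + 2) := by
    rw [show m + e + 2 = (m + e + 1) + 1 by ring, show e + 2 = (e + 1) + 1 by ring, Nat.choose_succ_succ]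
  have h2 : Nat.choose (m + e + 4) (e + 4) = Nat.choose (m + e + 3) (e + 3) + Nat.choose (m + e + 3) (e + 4) := by
    rw [show m + e + 4 = (m + e + 3) + 1 by ring, show e + 4 = (e + 3) + 1 by ring, Nat.choose_succ_succ]
  rw [h1, h2]; push_cast; ring

/-- Cross-branch comparison: `BASE_Q(m) - BASE_G(m+1) = C(m+1, 2) - 2(m+1) + 1 + C(m+d-2, d-1)` (`d = e + 4`), the record's
`BASE_Q(m-1) - BASE_G(m) = C(m,2) - 2m + 1 + C(m+d-3, d-1)` shifted by one. -/
theorem baseQ_pred_sub_baseG (m e : ℕ) :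
    (((m ^ 2 : ℕ) : ℤ) + ((Nat.choose (m + 1) 2 : ℕ) : ℤ) - ((Nat.choose (m + e + 3) (e + 4) : ℕ) : ℤ))
      - ((((m + 1) ^ 2 : ℕ) : ℤ) + ((Nat.choose (m + e + 2) (e + 2) : ℕ) : ℤ) - ((Nat.choose (m + e + 4) (e + 4) : ℕ) : ℤ))
      = ((Nat.choose (m + 1) 2 : ℕ) : ℤ) - 2 * ((m : ℤ) + 1) + 1 + ((Nat.choose (m + e + 2) (e + 3) : ℕ) : ℤ) := by
  have h2 : Nat.choose (m + e + 4) (e + 4) = Nat.choose (m + e + 3) (e + 3) + Nat.choose (m + e + 3) (e + 4) := by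
    rw [show m + e + 4 = (m + e + 3) + 1 by ring, show e + 4 = (e + 3) + 1 by ring, Nat.choose_succ_succ]
  have h3 : Nat.choose (m + e + 3) (e + 3) = Nat.choose (m + e + 2) (e + 2) + Nat.choose (m + e + 2) (e + 3) := by
    rw [show m + e + 3 = (m + e + 2) + 1 by ring, show e + 3 = (e + 2) + 1 by ring, Nat.choose_succ_succ]
  rw [h2, h3]; push_cast; ring

/-- The `Q`-step is negative for `m ≥ 3` (`m = p + 3`), all `d = e + 4`: `3m + 2 < C(m+d-1, d-1)`. -/
theorem baseQ_step_neg (p e : ℕ) :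
    3 * ((p + 3 : ℕ) : ℤ) + 2 - ((Nat.choose ((p + 3) + e + 3) (e + 3) : ℕ) : ℤ) < 0 := by
  -- C(p+e+6, e+3) = C(p+e+6, p+3) ≥ C(p+6, p+3) = C(p+6, 3) ≥ 3p + 12 > 3p + 11
  have sym1 : Nat.choose ((p + 3) + e + 3) (e + 3) = Nat.choose ((p + 3) + (e + 3)) (p + 3) := by
    rw [show (p + 3) + e + 3 = (p + 3) + (e + 3) by ring, Nat.choose_symm_add]
  have mono : Nat.choose ((p + 3) + 3) (p + 3) ≤ Nat.choose ((p + 3) + (e + 3)) (p + 3) := Nat.choose_mono (p + 3) (by omega)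
  have sym2 : Nat.choose ((p + 3) + 3) (p + 3) = Nat.choose (p + 6) 3 := by
    rw [Nat.choose_symm_add, show (p + 3) + 3 = p + 6 by ring]
  have grow : ∀ p : ℕ, 3 * p + 12 ≤ Nat.choose (p + 6) 3 := by
    intro p
    induction p with
    | zero => decide
    | succ p ih =>
      have pas : Nat.choose (p + 1 + 6) 3 = Nat.choose (p + 6) 2 + Nat.choose (p + 6) 3 := by
        rw [show p + 1 + 6 = (p + 6) + 1 by ring, Nat.choose_succ_succ]
      have m2 : Nat.choose 6 2 ≤ Nat.choose (p + 6) 2 := Nat.choose_mono 2 (by omega)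
      have c62 : Nat.choose 6 2 = 15 := by decide
      omega
  have g := grow p
  push_cast
  omega

/-- The `G`-step is negative for `m ≥ 3` (`m = p + 3`), all `d = e + 4`: `2m + 1 + C(m+d-3, d-3) < C(m+d-1, d-1)`. -/
theorem baseG_step_neg (p e : ℕ) :
    2 * ((p + 3 : ℕ) : ℤ) + 1 + ((Nat.choose ((p + 3) + e + 1) (e + 1) : ℕ) : ℤ) - ((Nat.choose ((p + 3) + e + 3) (e + 3) : ℕ) : ℤ) < 0 := by
  -- C(m+e+3, e+3) = C(m+e+2, e+2) + C(m+e+2, e+3) = C(m+e+1, e+1) + C(m+e+1, e+2) + C(m+e+2, e+3), and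
  -- C(m+e+1, e+2) = C(m+e+1, m-1) ≥ C(m+1, m-1) = C(m+1, 2) ≥ C(4,2) = 6, C(m+e+2, e+3) ≥ C(m+2, 3) ≥ ... ≥ 2m - 4 suffices.
  have pas1 : Nat.choose ((p + 3) + e + 3) (e + 3) = Nat.choose ((p + 3) + e + 2) (e + 2) + Nat.choose ((p + 3) + e + 2) (e + 3) := by
    rw [show (p + 3) + e + 3 = ((p + 3) + e + 2) + 1 by ring, show e + 3 = (e + 2) + 1 by ring, Nat.choose_succ_succ]
  have pas2 : Nat.choose ((p + 3) + e + 2) (e + 2) = Nat.choose ((p + 3) + e + 1) (e + 1) + Nat.choose ((p + 3) + e + 1) (e + 2) := by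
    rw [show (p + 3) + e + 2 = ((p + 3) + e + 1) + 1 by ring, show e + 2 = (e + 1) + 1 by ring, Nat.choose_succ_succ]
  -- lower bound for C(p+e+4, e+2) = C((p+2)+(e+2), p+2) ≥ C((p+2)+2, p+2) = C(p+4, 2) ≥ C(4,2) = 6
  have symA : Nat.choose ((p + 3) + e + 1) (e + 2) = Nat.choose ((p + 2) + (e + 2)) (p + 2) := by
    rw [show (p + 3) + e + 1 = (p + 2) + (e + 2) by ring, Nat.choose_symm_add]
  have monoA : Nat.choose ((p + 2) + 2) (p + 2) ≤ Nat.choose ((p + 2) + (e + 2)) (p + 2) := Nat.choose_mono (p + 2) (by omega)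
  have symA2 : Nat.choose ((p + 2) + 2) (p + 2) = Nat.choose (p + 4) 2 := by
    rw [Nat.choose_symm_add, show (p + 2) + 2 = p + 4 by ring]
  have monoA3 : Nat.choose 4 2 ≤ Nat.choose (p + 4) 2 := Nat.choose_mono 2 (by omega)
  have c42 : Nat.choose 4 2 = 6 := by decide
  -- lower bound for C(p+e+5, e+3) = C((p+2)+(e+3), p+2) ≥ C((p+2)+3, p+2) = C(p+5, 3) ≥ 2p + 10
  have symB : Nat.choose ((p + 3) + e + 2) (e + 3) = Nat.choose ((p + 2) + (e + 3)) (p + 2) := by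
    rw [show (p + 3) + e + 2 = (p + 2) + (e + 3) by ring, Nat.choose_symm_add]
  have monoB : Nat.choose ((p + 2) + 3) (p + 2) ≤ Nat.choose ((p + 2) + (e + 3)) (p + 2) := Nat.choose_mono (p + 2) (by omega)
  have symB2 : Nat.choose ((p + 2) + 3) (p + 2) = Nat.choose (p + 5) 3 := by
    rw [Nat.choose_symm_add, show (p + 2) + 3 = p + 5 by ring]
  have growB : ∀ p : ℕ, 2 * p + 10 ≤ Nat.choose (p + 5) 3 := by
    intro p
    induction p with
    | zero => decide
    | succ p ih =>
      have pas : Nat.choose (p + 1 + 5) 3 = Nat.choose (p + 5) 2 + Nat.choose (p + 5) 3 := by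
        rw [show p + 1 + 5 = (p + 5) + 1 by ring, Nat.choose_succ_succ]
      have m2 : Nat.choose 5 2 ≤ Nat.choose (p + 5) 2 := Nat.choose_mono 2 (by omega)
      have c52 : Nat.choose 5 2 = 10 := by decide
      omega
  have gB := growB p
  push_cast
  omega

/-- ORDERINGS BOX (`4 ≤ k′ ≤ 8`, `4 ≤ d ≤ 10`).  With the list of §4d
`L = [E+1 (Σ°, r = k′), C(k′+d-3,d-2) (TOP, r = 0), P (r = 1, φ = k′), Q_2, …, Q_{k′-1}, P′ (r = 1), G_2, …, G_{k′-1}]`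
(`φ = 1` except `P` and `G_2` at `d = 4`, where `φ = 2`), a piece being ADMISSIBLE when its entry is `≤ E+1`:
(i) `TOP` is admissible and its entry is `≤` every admissible entry; (ii) when `P` is admissible, every admissible entry `<` the `P` entry is
`TOP` or (`d = 4` and `P′`); (iii) for every admissible `Q_r` or `G_r` (`2 ≤ r ≤ k′-1`, `G_2` at `d = 4` included with its `φ = 2`, and `P′` as
`r = 1` on the `G` side) every piece of larger `r` (the `Q_{r'}`, `G_{r'}` with `r' > r`, and `Σ°`) has entry `≥` its entry.  All by `decide`. -/
theorem orderings_box : ∀ k ∈ Finset.Icc 4 8, ∀ d ∈ Finset.Icc 4 10,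
    (fun (k d : ℕ) =>
      let E1 : ℤ := (Nat.choose (k + d - 1) d : ℤ) - (Nat.choose (k + 1) 2 : ℤ) - (k : ℤ) ^ 2 + 1
      let top : ℤ := (Nat.choose (k + d - 3) (d - 2) : ℤ)
      let bq : ℕ → ℤ := fun m => (m : ℤ) ^ 2 + (Nat.choose (m + 1) 2 : ℤ) - (Nat.choose (m + d - 1) d : ℤ)
      let bg : ℕ → ℤ := fun m => (m : ℤ) ^ 2 + (Nat.choose (m + d - 3) (d - 2) : ℤ) - (Nat.choose (m + d - 1) d : ℤ)
      let cP : ℤ := E1 - 1 + bq (k - 1) + k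
      let cQ : ℕ → ℤ := fun r => E1 - 1 + bq (k - r) + 1
      let cG : ℕ → ℤ := fun r => E1 - 1 + bg (k - r) + (if r = 2 ∧ d = 4 then 2 else 1)
      -- pieces with their r: (r, codim); Σ° has r = k, TOP r = 0, P and P′ r = 1
      let others : List (ℕ × ℤ) := ((List.range (k - 2)).map fun i => (i + 2, cQ (i + 2))) ++ ((List.range (k - 2)).map fun i => (i + 2, cG (i + 2))) ++ [(k, E1)]
      let adm : ℤ → Bool := fun c => decide (c ≤ E1)
      -- (i)
      (adm top && (others ++ [(1, cP), (1, cG 1)]).all (fun rc => !(adm rc.2) || decide (top ≤ rc.2)))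
      -- (ii)
      && (!(adm cP) || (others ++ [(1, cG 1)]).all (fun rc => !(adm rc.2) || decide (cP ≤ rc.2) || (decide (d = 4) && decide (rc = (1, cG 1)))))
      -- (iii) for σ among Q_r, G_r (r ≥ 2) and P′: all pieces of larger r have codim ≥ codim σ
      && ((others ++ [(1, cG 1)]).all (fun s => !(adm s.2) ||
            others.all (fun t => !(decide (s.1 < t.1)) || decide (s.2 ≤ t.2))))) k d = true := by
  decide

end Arithmetic

end Summit.HodgeConjecture.HodgeConjecture.HodgeLocus.Census.JumpFamilies
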